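import Summits.BirchSwinnertonDyer.BirchSwinnertonDyer.Theses.TangentCone
import Summits.BirchSwinnertonDyer.BirchSwinnertonDyer.Theorems.TangentConeEdgeCapOfFacts
import Summits.BirchSwinnertonDyer.BirchSwinnertonDyer.Theorems.TangentConeEdgeCapArcDivisibilityTransfer
import Summits.BirchSwinnertonDyer.BirchSwinnertonDyer.Theorems.TangentConeEdgeCapInterpolantOfGS
import Literature.NumberTheory.EllipticCurves.CuspFormLFunctionCriticalNonvanishingProofs
import Literature.NumberTheory.EllipticCurves.PAdicLFunction

/-!
# Line `ratio-measure-strassmann` for crux `TangentCone.EdgeCap` (stmt-BirchSwinnertonDyer-17609) — v8 (continuation lead c1)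

v8 (end of cycle 2, 2026-08-17): the heart stub is WEAKENED to its ∃-form. v7's A2 `stub_arcDivisibility` asked the arc bound
for EVERY interpolant; the transfer "one interpolant ⇒ every interpolant" is now a LANDED tree theorem
(`Theorems.arcDivisibility_of_exists`, file `TangentConeEdgeCapArcDivisibilityTransfer.lean`, pure `p`-adic analysis over the
landed layers D/S/U/T), so the registered heart becomes A2∃ `stub_arcDivisibilityExists` — for admissible `(W,p)` with (Br), a
coprime slope pair and GIVEN members at all progression weights, SOME integral `F` with non-zero weight-2 fibre, the ratio
interpolation and `‖F(arc t)‖ ≤ p^{C₀}‖t‖_p^{s_p}` — on paper exactly the 2001 two-variable tangent-cone Theorem C for the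
Greenberg–Stevens function (Ochiai's two-variable Euler-system divisibility over the arc ring + Mazur–Wiles fullness + control
at `(2,1)`; unprinted as an assembly, no carrier in the tree): the statement the lead recommends PROMOTING to a route item.
A2 (∀-form) is kept as a DERIVED theorem. The composition is imported from the landed `Theorems.EdgeCap_of_stubs`
(`TangentConeEdgeCapOfFacts.lean`, p155273), and A1 is derived from G + L in this file (`stub_interpolant_of`; its fact-level
twin `Theorems.interpolant_of_facts` is landed, p153728).

Open stubs of v8: M `stub_membersExist` (= Hida named fact `hida_exists_congruent_ordinary_newform`, reduction p147924) ·
G `stub_twoVariableInterpolation` (= named fact `greenbergStevens_kitagawa_twoVariable_interpolation` p152672, reduction p152673) ·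
L `stub_padicLFunctionNeZero` (= modularity `exists_isNewformOf` + Rohrlich (discharged), reduction p153322) ·
A2∃ `stub_arcDivisibilityExists` (the heart; PROMOTE). `EdgeCap_of : M → G → L → A2∃ → EdgeCap` is sorry-free; at fact level
`Theorems.EdgeCap_of_factsExists : Hida-fact → GS-fact → exists_isNewformOf → (A2∃ verbatim) → EdgeCap` is landed with the
transfer file, so once A2∃ is an item `X`, `EdgeCap` closes CONDITIONALLY on the three named facts by `EdgeCap_of_factsExists … X_holds`.

History: v7 (this seat, cycle 2: A1 derived from fact-shaped G + L; facts/reductions landed p152672/p152673/p153322/p153728/p155273);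
v6/v5 (lead `…-17609-0`, cycle 1: analytic half landed U p147403, S p147405, D p147852, T p147846, T4 p147781, M ⟸ Hida p147924;
skeleton-vet repair of the reference range); v1–v4 (crux strategist). Card: `Lines/ratio_measure_strassmann.md`; disproof:
`Disproof.lean`; vet: `SKELVET-stub_ratioInterpolant.md`.

## The crux (recall)

`EdgeCap`: for every elliptic `E/ℚ` (globally minimal `W`, `N = W.conductorNorm ℤ`), every ADMISSIBLE prime `p` (`5 ≤ p`,
good ordinary, `a_p² ≢ 1 (mod p)`, `ρ̄_{E,p}` surjective, isolation hypothesis (Br)) and every slope `a/b < 1/2` there are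
`J, C` such that for every branch member `(k, g, ι, s)` of the progression `k ≡ 2 (mod 2b(p−1))`, `k ≥ 2J+3`,
`b(s−1) = a(k−2)`, SOME odd `j ∈ [3, 2J+1]` has `‖ι(Λ(g,s)/Λ(g,j))‖ · p^{s_p (1 + v_p(k−2))} ≤ p^C`.

Disproof.lean used: §5 P1–P7 (P3 `a_p ≢ 1` consumed in the unit Euler factor at `n = s = 1`; P5 tame component on every
index; P6 uniqueness inside G's fact; P7 = A2∃ is the only genuine risk). Negatives index (BSD, 1 entry TamePinch/CM): no stub
is an instance.
-/

set_option linter.unusedVariables false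
set_option linter.dupNamespace false

noncomputable section

namespace Summit.BirchSwinnertonDyer.BirchSwinnertonDyer.Cruxes.EdgeCap.RatioMeasure

open Summit.BirchSwinnertonDyer.BirchSwinnertonDyer.Theses.TangentCone

/-! ## Registered stubs (statements fully expanded over tree declarations) -/

/-- **M · `stub_membersExist` — classical members of the Hida branch at the progression weights (arithmetic;
printed: Hida 1986, EPW 2005 Thms 2.1.2/2.2.2, Hida EMI Thm 4.1.29/Cor 4.1.30 + modularity).** For `p ≥ 5` of good
ordinary reduction and every `b > 0`, `t > 0` there is an ordinary newform `g ∈ S_k(Γ₀(N))`, `k = 2 + 2b(p−1)t`, with a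
`p`-adic embedding `ι` of its coefficient field congruent to `E` away from `Np`. Verbatim the body of the tree named fact
`Literature.NumberTheory.EllipticCurves.hida_exists_congruent_ordinary_newform` at these weights (`k > 2`,
`(p−1) ∣ (k−2)`); it makes stub A2 vacuity-safe (the interpolation clause of A2 speaks about members, so members must
exist for A2 to carry information) and is blocked exactly on that fact. [cite: EmertonPollackWeston2005, Thm. 2.2.2] -/
theorem stub_membersExist :
    ∀ (W : WeierstrassCurve ℚ) [W.IsElliptic] [W.IsGloballyMinimal] (_ : NeZero (W.conductorNorm ℤ)) (p : ℕ)
      [Fact p.Prime], 5 ≤ p → W.HasGoodReductionAtPrime p → ¬ (p : ℤ) ∣ W.frobeniusTrace p → ∀ (b : ℕ), 0 < b →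
      (∀ t : ℕ, 0 < t → ∃ (g : CuspForm (CongruenceSubgroup.Gamma0 (W.conductorNorm ℤ))
      ((2 + 2 * b * (p - 1) * t : ℕ) : ℤ)) (ι :
      Literature.NumberTheory.EllipticCurves.ModularForms.coeffField g →+* PadicAlgCl p),
      Literature.NumberTheory.EllipticCurves.ModularForms.IsNewform0 g ∧ ‖ι ⟨(UpperHalfPlane.qExpansion 1
      ⇑g).coeff p, Literature.NumberTheory.EllipticCurves.ModularForms.coeff_mem_coeffField g p⟩‖ = 1 ∧ (∀ ℓ
      : ℕ, ℓ.Prime → ¬ ℓ ∣ W.conductorNorm ℤ * p → ‖ι ⟨(UpperHalfPlane.qExpansion 1 ⇑g).coeff ℓ,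
      Literature.NumberTheory.EllipticCurves.ModularForms.coeff_mem_coeffField g ℓ⟩ - ((W.frobeniusTrace ℓ :
      ℤ) : PadicAlgCl p)‖ < 1)) := by
  sorry

/-- **G · `stub_twoVariableInterpolation` — the Greenberg–Stevens / Kitagawa two-variable `p`-adic `L`-function of
the Hida branch through `f_E`, in VALUE–NORM form (arithmetic; PRINTED: Greenberg–Stevens 1993 Thm 5.15 and
Kitagawa 1994 Thm 1.1 as recalled in Delbourgo 2008 Thm 4.11 / Def. 4.12 — interpolation at the arithmetic points
`P_{k,𝟙}` with the `𝕀`-adic periods `Per_{𝕀,λ_P}` of Delbourgo Def. 4.9, non-zero by Prop. 4.10 [Ki, 5.12]; Hida 1986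
control (`p ≥ 5`) + the isolation hypothesis (Br) give `𝕀 = Λ^{wt} = ℤ_p⟦X⟧` (Delbourgo §4.3: "if there is a unique
`p`-stabilised ordinary newform of tame conductor `N` then `𝕀 = Λ^{wt}`", so (UF) holds) and make every ordinary
newform `g ∈ S_k(Γ₀(N))`, `k ≡ 2 (mod p−1)`, `k > 2`, congruent to `E` away from `Np`, the weight-`k` member `𝐟_{P_k}`;
Shimura 1977 / Paşol–Popa 2013 Cor. 5.12 for `iⁿΛ(g,n)/ω ∈ K_g`).** For admissible `(W, p)` with (Br) there is an
INTEGRAL `F ∈ ℚ_p⟦X, Y⟧` (`X` = weight variable, `x_k = (1+p)^{k−2} − 1`; `Y` = cyclotomic variable on the `ω⁰`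
branch, `y_n = (1+p)^{n−1} − 1`, the tree's `T = γ − 1`, `γ = 1 + p`) such that
* (wt 2) its weight-`2` fibre is a NON-ZERO multiple of the Mazur–Swinnerton-Dyer `p`-adic `L`-function of `E`:
  `F(0, T) = c · L_p(f, α, T)` coefficientwise for the newform `f` of `W` and `α = unitRoot W p`
  (Delbourgo p. 100: `L_p^{GS}(𝐟, 𝟙, 2, s) = Per_{𝕀,λ_{P_2}} · L_{p,α,Ω}(f, s)`), and
* (interp) for every `k > 2` with `(p−1) ∣ (k−2)` and every ordinary newform `g ∈ S_k(Γ₀(N))` with a congruent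
  `p`-adic embedding `ι` there are a `p`-adic period `Ω ≠ 0`, the `ι`-adic unit root `α` of `X² − a_p(g)X + p^{k−1}`
  (`|α| = 1`, `α ≡ a_p(E)` modulo the maximal ideal — `U_p ∈ 𝕋_𝔪 = Λ` specialises to `α` at `P_k` and to the unit
  root of `E` at `P_2`) and a complex period `ω ≠ 0` with, for every odd `0 < n < k/2`, `n ≡ 1 (mod p−1)`:
  `iⁿ Λ(g,n)/ω ∈ K_g` and `‖F(x_k, y_n)‖ = ‖Ω‖ · ‖(1 − p^{n−1}/α)(1 − p^{k−1−n}/α)‖ · ‖ι(iⁿΛ(g,n)/ω)‖`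
  (Delbourgo Thm 4.11 at `ψ = 𝟙`, `j = n−1`: `j!(1 − p^j/a_p(𝐟_P)) Per L(𝐟_P, j+1)/((2πi)^j Ω_{𝐟_P})` with
  `L(𝐟_P, s) = (1 − p^{k−1−s}/α)L(g, s)` for the `p`-stabilised member and `j! L(g, j+1) = (2π)^{j+1} Λ(g, j+1)`).
Only norms are asserted (signs `± i^{•}` and the normalisation of `ω` are absorbed), only the special case needed here
(odd `n` left of the centre on the `ω⁰` branch, trivial tame character).
-- TODO(general form): GS93 Thm 5.15 interpolates `ψ x^j` for all Dirichlet `ψ` of conductor `p^n M` and all `0 ≤ j ≤ k−2`,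
-- over any primitive branch `𝕀` (not only `𝕀 = Λ`).
[cite: GreenbergStevens1993, Thm 5.15] [cite: Kitagawa1994, Thm 1.1] [cite: Delbourgo2008, Thm 4.11, Def. 4.12, Def. 4.9, Prop. 4.10 (pp. 96–100)]
[cite: Hida1986] -/
theorem stub_twoVariableInterpolation :
    ∀ (W : WeierstrassCurve ℚ) [W.IsElliptic] [W.IsGloballyMinimal] (_ : NeZero (W.conductorNorm ℤ)) (p : ℕ)
      [Fact p.Prime], 5 ≤ p → W.HasGoodReductionAtPrime p → ¬ (p : ℤ) ∣ W.frobeniusTrace p →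
      W.HasSurjectiveModNGaloisRep p → (∀ (M : ℕ) (_ : NeZero M) (g :
      CuspForm (CongruenceSubgroup.Gamma0 M) 2) (ι :
      Literature.NumberTheory.EllipticCurves.ModularForms.coeffField g →+* PadicAlgCl p), M ∣
      W.conductorNorm ℤ * p → Literature.NumberTheory.EllipticCurves.ModularForms.IsNewform0 g → ‖ι
      ⟨(UpperHalfPlane.qExpansion 1 ⇑g).coeff p,
      Literature.NumberTheory.EllipticCurves.ModularForms.coeff_mem_coeffField g p⟩‖ = 1 → (∀ ℓ : ℕ, ℓ.Prime
      → ¬ ℓ ∣ W.conductorNorm ℤ * p → ‖ι ⟨(UpperHalfPlane.qExpansion 1 ⇑g).coeff ℓ,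
      Literature.NumberTheory.EllipticCurves.ModularForms.coeff_mem_coeffField g ℓ⟩ - ((W.frobeniusTrace ℓ :
      ℤ) : PadicAlgCl p)‖ < 1) → M = W.conductorNorm ℤ ∧ ∀ n : ℕ, (UpperHalfPlane.qExpansion 1 ⇑g).coeff n =
      ((W.LFunction n : ℤ) : ℂ)) →
      ∃ F : MvPowerSeries (Fin 2) ℚ_[p], Literature.NumberTheory.EllipticCurves.IsPadicInt F ∧
        (∀ f : CuspForm (CongruenceSubgroup.Gamma0 (W.conductorNorm ℤ)) 2,
          Literature.NumberTheory.EllipticCurves.ModularForms.IsNewformOf W f →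
          ∃ c : ℚ_[p], c ≠ 0 ∧ ∀ i : ℕ, MvPowerSeries.coeff (Finsupp.single 1 i) F =
            c * PowerSeries.coeff i (Literature.NumberTheory.EllipticCurves.padicLFunction f
              (Literature.NumberTheory.EllipticCurves.unitRoot W p : ℚ_[p]))) ∧
        (∀ (k : ℤ) (g : CuspForm (CongruenceSubgroup.Gamma0 (W.conductorNorm ℤ)) k)
          (ι : Literature.NumberTheory.EllipticCurves.ModularForms.coeffField g →+* PadicAlgCl p),
          2 < k → ((p : ℤ) - 1) ∣ (k - 2) →
          Literature.NumberTheory.EllipticCurves.ModularForms.IsNewform0 g →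
          ‖ι ⟨(UpperHalfPlane.qExpansion 1 ⇑g).coeff p,
            Literature.NumberTheory.EllipticCurves.ModularForms.coeff_mem_coeffField g p⟩‖ = 1 →
          (∀ ℓ : ℕ, ℓ.Prime → ¬ ℓ ∣ W.conductorNorm ℤ * p → ‖ι ⟨(UpperHalfPlane.qExpansion 1 ⇑g).coeff ℓ,
            Literature.NumberTheory.EllipticCurves.ModularForms.coeff_mem_coeffField g ℓ⟩ -
              ((W.frobeniusTrace ℓ : ℤ) : PadicAlgCl p)‖ < 1) →
          ∃ (Ω α : PadicAlgCl p) (ω : ℂ), Ω ≠ 0 ∧ ω ≠ 0 ∧ ‖α‖ = 1 ∧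
            α ^ 2 - ι ⟨(UpperHalfPlane.qExpansion 1 ⇑g).coeff p,
              Literature.NumberTheory.EllipticCurves.ModularForms.coeff_mem_coeffField g p⟩ * α +
              (p : PadicAlgCl p) ^ (k - 1).toNat = 0 ∧
            ‖α - ((W.frobeniusTrace p : ℤ) : PadicAlgCl p)‖ < 1 ∧
            ∀ n : ℕ, 0 < n → 2 * (n : ℤ) < k → Odd n → (p - 1) ∣ (n - 1) →
              ∃ hmem : Complex.I ^ n * Literature.NumberTheory.EllipticCurves.ModularForms.completedLValue g n / ω ∈
                  Literature.NumberTheory.EllipticCurves.ModularForms.coeffField g,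
                ‖Literature.NumberTheory.EllipticCurves.padicEval₂ F ((1 + (p : ℚ_[p])) ^ (k - 2) - 1)
                    ((1 + (p : ℚ_[p])) ^ (n - 1) - 1)‖ =
                  ‖Ω‖ * ‖(1 - (p : PadicAlgCl p) ^ (n - 1) / α) * (1 - (p : PadicAlgCl p) ^ ((k - 1).toNat - n) / α)‖ *
                    ‖ι ⟨_, hmem⟩‖) := by
  sorry

/-- **L · `stub_padicLFunctionNeZero` — the weight-2 fibre input: modularity + Rohrlich (arithmetic; PRINTED and
already NAMED in the tree: `Literature.NumberTheory.EllipticCurves.ModularForms.exists_isNewformOf` (Wiles /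
Taylor–Wiles / Breuil–Conrad–Diamond–Taylor 2001 Thm A, level = conductor by Carayol) and
`Literature.NumberTheory.EllipticCurves.padicLFunction_ne_zero` (Rohrlich 1984, Theorem p. 409: `L(E,χ,1) ≠ 0` for
almost all `χ` of `p`-power conductor, hence `L_p(E,T) ≠ 0` by the interpolation property).** For a globally minimal
`W` (elliptic, `N = W.conductorNorm ℤ ≠ 0`) and a prime `p ≥ 5` of good ordinary reduction there is a newform
`f ∈ S_2(Γ₀(N))` attached to `W` whose Mazur–Swinnerton-Dyer `p`-adic `L`-function `L_p(f, α, T)`, `α = unitRoot W p`,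
is not the zero power series. Blocked exactly on those two named facts (the second at `IsOrdinaryAt W p`, which is
`HasGoodReductionAtPrime ∧ ¬ p ∣ a_p`, `isOrdinaryAt_iff`). [cite: BreuilConradDiamondTaylor2001, Thm. A]
[cite: RohrlichInventiones1984, Theorem (p. 409)] -/
theorem stub_padicLFunctionNeZero :
    ∀ (W : WeierstrassCurve ℚ) [W.IsElliptic] [W.IsGloballyMinimal] (_ : NeZero (W.conductorNorm ℤ)) (p : ℕ)
      [Fact p.Prime], 5 ≤ p → W.HasGoodReductionAtPrime p → ¬ (p : ℤ) ∣ W.frobeniusTrace p →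
      ∃ f : CuspForm (CongruenceSubgroup.Gamma0 (W.conductorNorm ℤ)) 2,
        Literature.NumberTheory.EllipticCurves.ModularForms.IsNewformOf W f ∧
        Literature.NumberTheory.EllipticCurves.padicLFunction f
          (Literature.NumberTheory.EllipticCurves.unitRoot W p : ℚ_[p]) ≠ 0 := by
  sorry

/-- **A2∃ · `stub_arcDivisibilityExists` — order `≥ s_p` along the arc for ONE interpolant (the HEART; arithmetic, the
UNPRINTED 2001 two-variable tangent-cone Thm C for the Greenberg–Stevens function: Ochiai 2005/2006 two-variable Euler-system
divisibility with (Im) from Mazur–Wiles 1986 §10 fullness, specialised to the regular arc quotient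
`ℤ_p⟦X,Y⟧/((1+Y)^b − (1+X)^a) ≅ ℤ_p⟦T⟧`, control at `(2,1)` (Nekovář 2006 §11) and `rank_{ℤ_p} M/TM ≤ ord_T char M`;
alternative: Kato 2004 Thm 17.4 per member + depth transport — crux ideas `arc-euler-system`, `mazur-wiles-fullness-unit-transvection`,
`deep-point-selmer-transport`, `selmer-depth-ladder`).** For admissible `(W, p)` with (Br), a coprime slope pair `a/b < 1/2`, and
given branch members at all progression weights `2 + 2b(p−1)t` (stub M makes this hypothesis dischargeable): there are an
INTEGRAL `F ∈ ℚ_p⟦X,Y⟧` with non-zero weight-2 fibre, satisfying the ratio interpolation (interp) of A1 at every typed member,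
and `C₀` with `‖F((1+p)^{2b(p−1)t} − 1, (1+p)^{2a(p−1)t} − 1)‖ ≤ p^{C₀} · ‖t‖_p^{s_p}` for every `t ≥ 1`,
`s_p = corank_{ℤ_p} Sel_{p^∞}(E/ℚ)`. The intended witness is `F_GS` (G + L give (interp), `interpolant_of_facts`); the ∀-form A2
follows by the landed transfer `Theorems.arcDivisibility_of_exists`. -/
theorem stub_arcDivisibilityExists :
    ∀ (W : WeierstrassCurve ℚ) [W.IsElliptic] [W.IsGloballyMinimal] (_ : NeZero (W.conductorNorm ℤ)) (p : ℕ)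
      [Fact p.Prime], 5 ≤ p → W.HasGoodReductionAtPrime p → ¬ (p : ℤ) ∣ W.frobeniusTrace p → ¬ (p : ℤ) ∣
      (W.frobeniusTrace p) ^ 2 - 1 → W.HasSurjectiveModNGaloisRep p → (∀ (M : ℕ) (_ : NeZero M) (g :
      CuspForm (CongruenceSubgroup.Gamma0 M) 2) (ι :
      Literature.NumberTheory.EllipticCurves.ModularForms.coeffField g →+* PadicAlgCl p), M ∣
      W.conductorNorm ℤ * p → Literature.NumberTheory.EllipticCurves.ModularForms.IsNewform0 g → ‖ι
      ⟨(UpperHalfPlane.qExpansion 1 ⇑g).coeff p,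
      Literature.NumberTheory.EllipticCurves.ModularForms.coeff_mem_coeffField g p⟩‖ = 1 → (∀ ℓ : ℕ, ℓ.Prime
      → ¬ ℓ ∣ W.conductorNorm ℤ * p → ‖ι ⟨(UpperHalfPlane.qExpansion 1 ⇑g).coeff ℓ,
      Literature.NumberTheory.EllipticCurves.ModularForms.coeff_mem_coeffField g ℓ⟩ - ((W.frobeniusTrace ℓ :
      ℤ) : PadicAlgCl p)‖ < 1) → M = W.conductorNorm ℤ ∧ ∀ n : ℕ, (UpperHalfPlane.qExpansion 1 ⇑g).coeff n =
      ((W.LFunction n : ℤ) : ℂ)) → ∀ (a b : ℕ), 0 < b → 2 * a < b → a.Coprime b → (∀ t : ℕ, 0 < t → ∃ (g : CuspForm (CongruenceSubgroup.Gamma0 (W.conductorNorm ℤ))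
      ((2 + 2 * b * (p - 1) * t : ℕ) : ℤ)) (ι :
      Literature.NumberTheory.EllipticCurves.ModularForms.coeffField g →+* PadicAlgCl p),
      Literature.NumberTheory.EllipticCurves.ModularForms.IsNewform0 g ∧ ‖ι ⟨(UpperHalfPlane.qExpansion 1
      ⇑g).coeff p, Literature.NumberTheory.EllipticCurves.ModularForms.coeff_mem_coeffField g p⟩‖ = 1 ∧ (∀ ℓ
      : ℕ, ℓ.Prime → ¬ ℓ ∣ W.conductorNorm ℤ * p → ‖ι ⟨(UpperHalfPlane.qExpansion 1 ⇑g).coeff ℓ,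
      Literature.NumberTheory.EllipticCurves.ModularForms.coeff_mem_coeffField g ℓ⟩ - ((W.frobeniusTrace ℓ :
      ℤ) : PadicAlgCl p)‖ < 1)) →
      ∃ F : MvPowerSeries (Fin 2) ℚ_[p], Literature.NumberTheory.EllipticCurves.IsPadicInt F ∧ (∃ i : ℕ, MvPowerSeries.coeff (Finsupp.single 1 i) F ≠ 0) ∧
      (∀ (k : ℤ) (g : CuspForm
      (CongruenceSubgroup.Gamma0 (W.conductorNorm ℤ)) k) (ι :
      Literature.NumberTheory.EllipticCurves.ModularForms.coeffField g →+* PadicAlgCl p) (s : ℕ), (2 * b *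
      (p - 1) : ℤ) ∣ (k - 2) → (b : ℤ) * ((s : ℤ) - 1) = a * (k - 2) →
      Literature.NumberTheory.EllipticCurves.ModularForms.IsNewform0 g → ‖ι ⟨(UpperHalfPlane.qExpansion 1
      ⇑g).coeff p, Literature.NumberTheory.EllipticCurves.ModularForms.coeff_mem_coeffField g p⟩‖ = 1 → (∀ ℓ
      : ℕ, ℓ.Prime → ¬ ℓ ∣ W.conductorNorm ℤ * p → ‖ι ⟨(UpperHalfPlane.qExpansion 1 ⇑g).coeff ℓ,
      Literature.NumberTheory.EllipticCurves.ModularForms.coeff_mem_coeffField g ℓ⟩ - ((W.frobeniusTrace ℓ :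
      ℤ) : PadicAlgCl p)‖ < 1) → ∀ j : ℕ, Odd j → 3 ≤ j → (p - 1) ∣ (j - 1) → 2 * (j : ℤ) + 2 ≤ k →
      Literature.NumberTheory.EllipticCurves.padicEval₂ F ((1 + (p : ℚ_[p])) ^ (k - 2) - 1) ((1 + (p :
      ℚ_[p])) ^ (j - 1) - 1) ≠ 0 ∧ ∀ hR : (∫ t in Set.Ioi (0 : ℝ), ((t : ℂ) ^ (s - 1)) * g
      (UpperHalfPlane.ofComplex ((t : ℂ) * Complex.I))) / (∫ t in Set.Ioi (0 : ℝ), ((t : ℂ) ^ (j - 1)) * g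
      (UpperHalfPlane.ofComplex ((t : ℂ) * Complex.I))) ∈
      Literature.NumberTheory.EllipticCurves.ModularForms.coeffField g, ‖ι ⟨_, hR⟩‖ *
      ‖Literature.NumberTheory.EllipticCurves.padicEval₂ F ((1 + (p : ℚ_[p])) ^ (k - 2) - 1) ((1 + (p :
      ℚ_[p])) ^ (j - 1) - 1)‖ = ‖Literature.NumberTheory.EllipticCurves.padicEval₂ F ((1 + (p : ℚ_[p])) ^ (k
      - 2) - 1) ((1 + (p : ℚ_[p])) ^ (s - 1) - 1)‖) ∧
      ∃ C₀ : ℕ, ∀ t : ℕ, 0 < t → ‖Literature.NumberTheory.EllipticCurves.padicEval₂ F ((1 + (p : ℚ_[p])) ^ (2 * b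
      * (p - 1) * t) - 1) ((1 + (p : ℚ_[p])) ^ (2 * a * (p - 1) * t) - 1)‖ ≤ (p : ℝ) ^ C₀ * ‖(t : ℚ_[p])‖ ^
      W.selmerCorank p := by
  sorry

/-- **A2 · `stub_arcDivisibility` (DERIVED in v8 from A2∃ by the landed transfer; registered statement of v5–v7 unchanged)** —
the arc bound for EVERY integral interpolant with non-zero weight-2 fibre and (interp), given members at all progression weights. -/
theorem stub_arcDivisibility :
    ∀ (W : WeierstrassCurve ℚ) [W.IsElliptic] [W.IsGloballyMinimal] (_ : NeZero (W.conductorNorm ℤ)) (p : ℕ)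
      [Fact p.Prime], 5 ≤ p → W.HasGoodReductionAtPrime p → ¬ (p : ℤ) ∣ W.frobeniusTrace p → ¬ (p : ℤ) ∣
      (W.frobeniusTrace p) ^ 2 - 1 → W.HasSurjectiveModNGaloisRep p → (∀ (M : ℕ) (_ : NeZero M) (g :
      CuspForm (CongruenceSubgroup.Gamma0 M) 2) (ι :
      Literature.NumberTheory.EllipticCurves.ModularForms.coeffField g →+* PadicAlgCl p), M ∣
      W.conductorNorm ℤ * p → Literature.NumberTheory.EllipticCurves.ModularForms.IsNewform0 g → ‖ι
      ⟨(UpperHalfPlane.qExpansion 1 ⇑g).coeff p,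
      Literature.NumberTheory.EllipticCurves.ModularForms.coeff_mem_coeffField g p⟩‖ = 1 → (∀ ℓ : ℕ, ℓ.Prime
      → ¬ ℓ ∣ W.conductorNorm ℤ * p → ‖ι ⟨(UpperHalfPlane.qExpansion 1 ⇑g).coeff ℓ,
      Literature.NumberTheory.EllipticCurves.ModularForms.coeff_mem_coeffField g ℓ⟩ - ((W.frobeniusTrace ℓ :
      ℤ) : PadicAlgCl p)‖ < 1) → M = W.conductorNorm ℤ ∧ ∀ n : ℕ, (UpperHalfPlane.qExpansion 1 ⇑g).coeff n =
      ((W.LFunction n : ℤ) : ℂ)) → ∀ (a b : ℕ), 0 < b → 2 * a < b → a.Coprime b → ∀ F : MvPowerSeries (Fin 2)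
      ℚ_[p], Literature.NumberTheory.EllipticCurves.IsPadicInt F → (∃ i : ℕ, MvPowerSeries.coeff (Finsupp.single 1 i) F ≠ 0) →
      (∀ (k : ℤ) (g : CuspForm
      (CongruenceSubgroup.Gamma0 (W.conductorNorm ℤ)) k) (ι :
      Literature.NumberTheory.EllipticCurves.ModularForms.coeffField g →+* PadicAlgCl p) (s : ℕ), (2 * b *
      (p - 1) : ℤ) ∣ (k - 2) → (b : ℤ) * ((s : ℤ) - 1) = a * (k - 2) →
      Literature.NumberTheory.EllipticCurves.ModularForms.IsNewform0 g → ‖ι ⟨(UpperHalfPlane.qExpansion 1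
      ⇑g).coeff p, Literature.NumberTheory.EllipticCurves.ModularForms.coeff_mem_coeffField g p⟩‖ = 1 → (∀ ℓ
      : ℕ, ℓ.Prime → ¬ ℓ ∣ W.conductorNorm ℤ * p → ‖ι ⟨(UpperHalfPlane.qExpansion 1 ⇑g).coeff ℓ,
      Literature.NumberTheory.EllipticCurves.ModularForms.coeff_mem_coeffField g ℓ⟩ - ((W.frobeniusTrace ℓ :
      ℤ) : PadicAlgCl p)‖ < 1) → ∀ j : ℕ, Odd j → 3 ≤ j → (p - 1) ∣ (j - 1) → 2 * (j : ℤ) + 2 ≤ k →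
      Literature.NumberTheory.EllipticCurves.padicEval₂ F ((1 + (p : ℚ_[p])) ^ (k - 2) - 1) ((1 + (p :
      ℚ_[p])) ^ (j - 1) - 1) ≠ 0 ∧ ∀ hR : (∫ t in Set.Ioi (0 : ℝ), ((t : ℂ) ^ (s - 1)) * g
      (UpperHalfPlane.ofComplex ((t : ℂ) * Complex.I))) / (∫ t in Set.Ioi (0 : ℝ), ((t : ℂ) ^ (j - 1)) * g
      (UpperHalfPlane.ofComplex ((t : ℂ) * Complex.I))) ∈
      Literature.NumberTheory.EllipticCurves.ModularForms.coeffField g, ‖ι ⟨_, hR⟩‖ *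
      ‖Literature.NumberTheory.EllipticCurves.padicEval₂ F ((1 + (p : ℚ_[p])) ^ (k - 2) - 1) ((1 + (p :
      ℚ_[p])) ^ (j - 1) - 1)‖ = ‖Literature.NumberTheory.EllipticCurves.padicEval₂ F ((1 + (p : ℚ_[p])) ^ (k
      - 2) - 1) ((1 + (p : ℚ_[p])) ^ (s - 1) - 1)‖) →
      (∀ t : ℕ, 0 < t → ∃ (g : CuspForm (CongruenceSubgroup.Gamma0 (W.conductorNorm ℤ))
      ((2 + 2 * b * (p - 1) * t : ℕ) : ℤ)) (ι :
      Literature.NumberTheory.EllipticCurves.ModularForms.coeffField g →+* PadicAlgCl p),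
      Literature.NumberTheory.EllipticCurves.ModularForms.IsNewform0 g ∧ ‖ι ⟨(UpperHalfPlane.qExpansion 1
      ⇑g).coeff p, Literature.NumberTheory.EllipticCurves.ModularForms.coeff_mem_coeffField g p⟩‖ = 1 ∧ (∀ ℓ
      : ℕ, ℓ.Prime → ¬ ℓ ∣ W.conductorNorm ℤ * p → ‖ι ⟨(UpperHalfPlane.qExpansion 1 ⇑g).coeff ℓ,
      Literature.NumberTheory.EllipticCurves.ModularForms.coeff_mem_coeffField g ℓ⟩ - ((W.frobeniusTrace ℓ :
      ℤ) : PadicAlgCl p)‖ < 1)) →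
      ∃ C₀ : ℕ, ∀ t : ℕ, 0 < t → ‖Literature.NumberTheory.EllipticCurves.padicEval₂ F ((1 + (p : ℚ_[p])) ^ (2 * b
      * (p - 1) * t) - 1) ((1 + (p : ℚ_[p])) ^ (2 * a * (p - 1) * t) - 1)‖ ≤ (p : ℝ) ^ C₀ * ‖(t : ℚ_[p])‖ ^
      W.selmerCorank p :=
  Summit.BirchSwinnertonDyer.BirchSwinnertonDyer.Theorems.arcDivisibility_of_exists stub_arcDivisibilityExists

/-- **D · `stub_contentDivision` — dividing out the vertical zeros (`p`-adic analysis). LANDED p147852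
(`Theorems/TangentConeEdgeCapStubContentDivision.lean`, wave-1 stub worker; termination by growth of the weight-2
coefficient norm under division).** An integral
`F ∈ ℚ_p⟦X, Y⟧` whose weight-2 fibre series `F(0, Y)` is non-zero factors, as a function on the open bidisc of `ℚ_p`, as
`F(x, y) = (∏_{z ∈ zs} (x − z)) · Q(x, y)` with `Q` INTEGRAL, `zs` a finite list of NON-ZERO points of the open disc
(repetitions = multiplicities), and NO weight fibre of `Q` vanishing identically on the disc. Proof plan: if every fibre
coefficient `f_i(X) = Σ_m F_{m,i} X^m` vanishes at some `z` (`‖z‖ < 1`; `z ≠ 0` by the weight-2 hypothesis), then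
`F = (X − z)·Q` with `Q_{l,i} = Σ_{n>l} F_{n,i} z^{n−1−l}` integral and `Q(0,·) ≠ 0`; for the non-zero fibre coefficient
`f_{i₀}` (`i₀` from the hypothesis) the FIRST index at which `|F_{n,i₀}|` attains its maximum drops by exactly one under
this division (ultrametric estimate), so the process stops; when no such `z` is left, each fibre series is non-zero, hence
(Strassmann, `MemIwasawaRat.finite_setOf_hasSum_zero`) non-zero at some point of the `ℚ_p`-disc. Evaluation calculus:
`padicEval₂_mul`, `padicEval₂_sub`, `padicEval₂_C`, fibre expansion `EdgeCap.Negative.padicEval₂_eq_tsum_fibre`. [folklore] -/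
theorem stub_contentDivision :
    ∀ (p : ℕ) [Fact p.Prime] (F : MvPowerSeries (Fin 2) ℚ_[p]), Literature.NumberTheory.EllipticCurves.IsPadicInt F →
      (∃ i : ℕ, MvPowerSeries.coeff (Finsupp.single 1 i) F ≠ 0) →
      ∃ (Q : MvPowerSeries (Fin 2) ℚ_[p]) (zs : List ℚ_[p]), Literature.NumberTheory.EllipticCurves.IsPadicInt Q ∧
        (∀ z ∈ zs, z ≠ 0 ∧ ‖z‖ < 1) ∧
        (∀ x y : ℚ_[p], ‖x‖ < 1 → ‖y‖ < 1 →
          Literature.NumberTheory.EllipticCurves.padicEval₂ F x y =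
            (zs.map fun z => x - z).prod * Literature.NumberTheory.EllipticCurves.padicEval₂ Q x y) ∧
        (∀ x : ℚ_[p], ‖x‖ < 1 → ∃ y : ℚ_[p], ‖y‖ < 1 ∧ Literature.NumberTheory.EllipticCurves.padicEval₂ Q x y ≠ 0) :=
  Summit.BirchSwinnertonDyer.BirchSwinnertonDyer.Theorems.stub_contentDivision

/-- **T · `stub_normOneAddPowSubOne` — `‖(1+p)^n − 1‖_p ≤ ‖p‖_p · ‖n‖_p` (elementary). LANDED p147846
(`Theorems/TangentConeEdgeCapStubNormOneAddPowSubOne.lean`, wave-1 stub worker, lifting the exponent).** The weight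
coordinate of the `t`-th progression point is `p`-adically no larger than `t`: `v_p((1+p)^n − 1) ≥ 1 + v_p(n)` (binomial
expansion: `v_p(C(n,k) p^k) ≥ v_p(n) − v_p(k) + k ≥ v_p(n) + 1` for `k ≥ 1`; or lifting the exponent). True for every
odd prime `p` (stated for `p ≠ 2`, which is all `EdgeCap_of` needs; Mathlib: `padicValNat.pow_sub_pow`, lifting the
exponent, `NumberTheory/Multiplicity.lean`). Used by `EdgeCap_of` to separate the
progression points from the non-zero vertical zeros `z`: `‖t‖_p < ‖z‖ ⇒ ‖x_t − z‖ = ‖z‖`. [folklore] -/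
theorem stub_normOneAddPowSubOne :
    ∀ (p : ℕ) [Fact p.Prime], p ≠ 2 → ∀ n : ℕ, ‖(1 + (p : ℚ_[p])) ^ n - 1‖ ≤ ‖(p : ℚ_[p])‖ * ‖(n : ℚ_[p])‖ :=
  Summit.BirchSwinnertonDyer.BirchSwinnertonDyer.Theorems.stub_normOneAddPowSubOne

/-! ## Stub statements by name -/

namespace Statement

/-- Statement of `stub_membersExist` (M). -/
abbrev stub_membersExist : Prop := type_of% @RatioMeasure.stub_membersExist
/-- Statement of `stub_twoVariableInterpolation` (G). -/
abbrev stub_twoVariableInterpolation : Prop := type_of% @RatioMeasure.stub_twoVariableInterpolation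
/-- Statement of `stub_padicLFunctionNeZero` (L). -/
abbrev stub_padicLFunctionNeZero : Prop := type_of% @RatioMeasure.stub_padicLFunctionNeZero
/-- Statement of `stub_arcDivisibilityExists` (A2∃, the heart). -/
abbrev stub_arcDivisibilityExists : Prop := type_of% @RatioMeasure.stub_arcDivisibilityExists
/-- Statement of `stub_arcDivisibility` (A2, derived). -/
abbrev stub_arcDivisibility : Prop := type_of% @RatioMeasure.stub_arcDivisibility
/-- Statement of `stub_contentDivision` (D, landed). -/
abbrev stub_contentDivision : Prop := type_of% @RatioMeasure.stub_contentDivision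
/-- Statement of `stub_normOneAddPowSubOne` (T, landed). -/
abbrev stub_normOneAddPowSubOne : Prop := type_of% @RatioMeasure.stub_normOneAddPowSubOne
end Statement

/-! ## A1 `stub_interpolant` DERIVED (v7) from G `stub_twoVariableInterpolation` and L `stub_padicLFunctionNeZero`

The ratio/norm interpolation with non-vanishing at the reference points, for EVERY typed branch member: divide
two instances (`n = s` and `n = j`) of G's value formula at the same `(k, g, ι)` — same `Ω`, same `ω`, unit Euler
factors (`norm_eulerFactor_eq_one`; at `n = s = 1` this is where `a_p ≢ 1 (mod p)` enters) — and use
`iˢΛ(g,s)/ω = ±(Λ(g,s)/Λ(g,j))·(iʲΛ(g,j)/ω)` in `K_g`; the reference value is non-zero by T4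
(`IsNewform0.completedLValue_ne_zero_of_two_mul_add_two_lt`, `2j+2 < k` because `k ≡ 2 (mod 4)` on the progression and
`j` is odd) and `Ω ≠ 0`; the weight-2 fibre is non-zero because it is `c·L_p(f,α,T)` with `c ≠ 0` (G) and
`L_p(f,α,T) ≠ 0` (L). -/

open Complex Literature.NumberTheory.EllipticCurves Literature.NumberTheory.EllipticCurves.ModularForms
  Summit.BirchSwinnertonDyer.BirchSwinnertonDyer.Theorems.TangentConeEdgeCap in
/-- **A1 from G and L.** The statement of stub A1 `stub_interpolant` (v5/v6, registered) follows from the statements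
of G `stub_twoVariableInterpolation` and L `stub_padicLFunctionNeZero`. -/
theorem stub_interpolant_of (hG : Statement.stub_twoVariableInterpolation)
    (hL : Statement.stub_padicLFunctionNeZero) :
    ∀ (W : WeierstrassCurve ℚ) [W.IsElliptic] [W.IsGloballyMinimal] (_ : NeZero (W.conductorNorm ℤ)) (p : ℕ)
      [Fact p.Prime], 5 ≤ p → W.HasGoodReductionAtPrime p → ¬ (p : ℤ) ∣ W.frobeniusTrace p → ¬ (p : ℤ) ∣
      (W.frobeniusTrace p) ^ 2 - 1 → W.HasSurjectiveModNGaloisRep p → (∀ (M : ℕ) (_ : NeZero M) (g :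
      CuspForm (CongruenceSubgroup.Gamma0 M) 2) (ι :
      Literature.NumberTheory.EllipticCurves.ModularForms.coeffField g →+* PadicAlgCl p), M ∣
      W.conductorNorm ℤ * p → Literature.NumberTheory.EllipticCurves.ModularForms.IsNewform0 g → ‖ι
      ⟨(UpperHalfPlane.qExpansion 1 ⇑g).coeff p,
      Literature.NumberTheory.EllipticCurves.ModularForms.coeff_mem_coeffField g p⟩‖ = 1 → (∀ ℓ : ℕ, ℓ.Prime
      → ¬ ℓ ∣ W.conductorNorm ℤ * p → ‖ι ⟨(UpperHalfPlane.qExpansion 1 ⇑g).coeff ℓ,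
      Literature.NumberTheory.EllipticCurves.ModularForms.coeff_mem_coeffField g ℓ⟩ - ((W.frobeniusTrace ℓ :
      ℤ) : PadicAlgCl p)‖ < 1) → M = W.conductorNorm ℤ ∧ ∀ n : ℕ, (UpperHalfPlane.qExpansion 1 ⇑g).coeff n =
      ((W.LFunction n : ℤ) : ℂ)) → ∀ (a b : ℕ), 0 < b → 2 * a < b → a.Coprime b → ∃ F : MvPowerSeries (Fin
      2) ℚ_[p], Literature.NumberTheory.EllipticCurves.IsPadicInt F ∧ (∃ i : ℕ, MvPowerSeries.coeff (Finsupp.single 1 i) F ≠ 0) ∧ (∀ (k : ℤ) (g : CuspForm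
      (CongruenceSubgroup.Gamma0 (W.conductorNorm ℤ)) k) (ι :
      Literature.NumberTheory.EllipticCurves.ModularForms.coeffField g →+* PadicAlgCl p) (s : ℕ), (2 * b *
      (p - 1) : ℤ) ∣ (k - 2) → (b : ℤ) * ((s : ℤ) - 1) = a * (k - 2) →
      Literature.NumberTheory.EllipticCurves.ModularForms.IsNewform0 g → ‖ι ⟨(UpperHalfPlane.qExpansion 1
      ⇑g).coeff p, Literature.NumberTheory.EllipticCurves.ModularForms.coeff_mem_coeffField g p⟩‖ = 1 → (∀ ℓ
      : ℕ, ℓ.Prime → ¬ ℓ ∣ W.conductorNorm ℤ * p → ‖ι ⟨(UpperHalfPlane.qExpansion 1 ⇑g).coeff ℓ,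
      Literature.NumberTheory.EllipticCurves.ModularForms.coeff_mem_coeffField g ℓ⟩ - ((W.frobeniusTrace ℓ :
      ℤ) : PadicAlgCl p)‖ < 1) → ∀ j : ℕ, Odd j → 3 ≤ j → (p - 1) ∣ (j - 1) → 2 * (j : ℤ) + 2 ≤ k →
      Literature.NumberTheory.EllipticCurves.padicEval₂ F ((1 + (p : ℚ_[p])) ^ (k - 2) - 1) ((1 + (p :
      ℚ_[p])) ^ (j - 1) - 1) ≠ 0 ∧ ∀ hR : (∫ t in Set.Ioi (0 : ℝ), ((t : ℂ) ^ (s - 1)) * g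
      (UpperHalfPlane.ofComplex ((t : ℂ) * Complex.I))) / (∫ t in Set.Ioi (0 : ℝ), ((t : ℂ) ^ (j - 1)) * g
      (UpperHalfPlane.ofComplex ((t : ℂ) * Complex.I))) ∈
      Literature.NumberTheory.EllipticCurves.ModularForms.coeffField g, ‖ι ⟨_, hR⟩‖ *
      ‖Literature.NumberTheory.EllipticCurves.padicEval₂ F ((1 + (p : ℚ_[p])) ^ (k - 2) - 1) ((1 + (p :
      ℚ_[p])) ^ (j - 1) - 1)‖ = ‖Literature.NumberTheory.EllipticCurves.padicEval₂ F ((1 + (p : ℚ_[p])) ^ (k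
      - 2) - 1) ((1 + (p : ℚ_[p])) ^ (s - 1) - 1)‖) := by
  intro W _ _ hN p _ h5 hgood hord hna hsurj hBr a b hb hab hcop
  obtain ⟨F, hFi, hwt2, hval⟩ := hG W hN p h5 hgood hord hsurj hBr
  refine ⟨F, hFi, ?_, ?_⟩
  · -- (wt-2): the weight-2 fibre series is `c · L_p(f, α, T) ≠ 0`
    obtain ⟨f, hf, hLne⟩ := hL W hN p h5 hgood hord
    obtain ⟨c, hc, hcoeff⟩ := hwt2 f hf
    by_contra hall
    push Not at hall
    apply hLne
    ext i
    have h := hcoeff i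
    rw [hall i] at h
    rw [map_zero]
    rcases mul_eq_zero.mp h.symm with h0 | h0
    · exact absurd h0 hc
    · exact h0
  · intro k g ι s hdiv hs hnew hordg hcong j hjodd hj3 hjp hjk
    -- numerology of the progression
    have hp1 : 1 ≤ p := by omega
    have hp2 : p ≠ 2 := by omega
    obtain ⟨r, hr⟩ : Odd p := (Fact.out : p.Prime).eq_two_or_odd'.resolve_left hp2
    obtain ⟨q, hq⟩ := hdiv
    have hb0 : (0 : ℤ) < b := by exact_mod_cast hb
    have hpm : (0 : ℤ) < (p : ℤ) - 1 := by omega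
    have hk8 : (8 : ℤ) ≤ k := by omega
    have hc0 : (0 : ℤ) < 2 * (b : ℤ) * ((p : ℤ) - 1) := mul_pos (mul_pos two_pos hb0) hpm
    have hq0 : 0 < q := by
      rcases lt_trichotomy q 0 with h | h | h
      · have : 2 * (b : ℤ) * ((p : ℤ) - 1) * q < 0 := mul_neg_of_pos_of_neg hc0 h
        omega
      · subst h; simp at hq; omega
      · exact h
    have hs1 : (s : ℤ) - 1 = 2 * a * ((p : ℤ) - 1) * q := by
      have h1 : (b : ℤ) * ((s : ℤ) - 1) = (b : ℤ) * (2 * a * ((p : ℤ) - 1) * q) := by rw [hs, hq]; ring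
      exact mul_left_cancel₀ hb0.ne' h1
    have hapq : (0 : ℤ) ≤ 2 * (a : ℤ) * ((p : ℤ) - 1) * q :=
      mul_nonneg (mul_nonneg (by positivity) hpm.le) hq0.le
    have hs0 : 0 < s := by omega
    have h2s : 2 * (s : ℤ) < k := by
      have hab' : (2 * (a : ℤ)) < b := by exact_mod_cast hab
      have hpq : (0 : ℤ) < ((p : ℤ) - 1) * q := mul_pos hpm hq0
      nlinarith [mul_lt_mul_of_pos_right hab' hpq, hs1, hq]
    have hsodd : Odd s :=
      (Int.odd_coe_nat s).mp ⟨(a : ℤ) * ((p : ℤ) - 1) * q, by linarith [hs1]⟩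
    have hsp : (p - 1) ∣ (s - 1) := by
      obtain ⟨t, rfl⟩ := Int.eq_ofNat_of_zero_le hq0.le
      have h : ((p - 1 : ℕ) : ℤ) ∣ ((s - 1 : ℕ) : ℤ) := by
        refine ⟨2 * a * t, ?_⟩
        rw [Nat.cast_sub (by omega), Nat.cast_sub hp1]
        push_cast
        linear_combination hs1
      exact Int.natCast_dvd_natCast.mp h
    have hk2 : 2 < k := by omega
    have hpk : ((p : ℤ) - 1) ∣ (k - 2) := ⟨2 * b * q, by rw [hq]; ring⟩
    -- `k ≡ 2 (mod 4)` and `j` odd give T4's strict inequality `2j + 2 < k`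
    have hjlt : 2 * (j : ℤ) + 2 < k := by
      obtain ⟨m, hm⟩ := hjodd
      obtain ⟨M4, hM4⟩ : ∃ M4 : ℤ, k - 2 = 4 * M4 := ⟨(b : ℤ) * r * q, by rw [hq, hr]; push_cast; ring⟩
      omega
    have hj2 : 2 * (j : ℤ) < k := by omega
    -- the member data from G at `(k, g, ι)`, at `n = j` and at `n = s`
    obtain ⟨Ω, α, ω, hΩ, hω, hαn, -, hαcong, hvals⟩ := hval k g ι hk2 hpk hnew hordg hcong
    obtain ⟨hmj, hFj⟩ := hvals j (by omega) hj2 hjodd hjp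
    obtain ⟨hms, hFs⟩ := hvals s hs0 h2s hsodd hsp
    -- unit Euler factors
    have hna1 : ¬ (p : ℤ) ∣ W.frobeniusTrace p - 1 := by
      intro h
      apply hna
      have : (W.frobeniusTrace p) ^ 2 - 1 = (W.frobeniusTrace p - 1) * (W.frobeniusTrace p + 1) := by ring
      rw [this]
      exact h.mul_right _
    have hK : ∀ n : ℕ, 2 * (n : ℤ) < k → n < (k - 1).toNat := by
      intro n hn
      have : ((k - 1).toNat : ℤ) = k - 1 := Int.toNat_of_nonneg (by omega)
      omega
    rw [norm_eulerFactor_eq_one hαn hαcong hna1 (by omega : 0 < j) (hK j hj2), mul_one] at hFj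
    rw [norm_eulerFactor_eq_one hαn hαcong hna1 hs0 (hK s h2s), mul_one] at hFs
    -- abbreviations
    set xk : ℚ_[p] := (1 + (p : ℚ_[p])) ^ (k - 2) - 1 with hxk
    set Aj : ℂ := I ^ j * completedLValue g j / ω with hAj
    set As : ℂ := I ^ s * completedLValue g s / ω with hAs
    -- non-vanishing of the reference value (T4) and of its `ι`-image
    have hΛj : completedLValue g j ≠ 0 :=
      hnew.completedLValue_ne_zero_of_two_mul_add_two_lt (by omega) hjlt
    have hAj0 : Aj ≠ 0 := by
      rw [hAj]
      exact div_ne_zero (mul_ne_zero (pow_ne_zero _ I_ne_zero) hΛj) hω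
    have hιAj0 : ι ⟨Aj, hmj⟩ ≠ 0 := by
      rw [map_ne_zero ι]
      exact fun h => hAj0 (congrArg Subtype.val h)
    have hΩ' : 0 < ‖Ω‖ := norm_pos_iff.mpr hΩ
    refine ⟨?_, fun hR => ?_⟩
    · -- `F(x_k, y_j) ≠ 0`
      intro h0
      rw [h0, norm_zero] at hFj
      have : 0 < ‖Ω‖ * ‖ι ⟨Aj, hmj⟩‖ := mul_pos hΩ' (norm_pos_iff.mpr hιAj0)
      linarith
    · -- the ratio identity: `Λ(g,s)/Λ(g,j) · Aj = ± As` in `K_g`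
      obtain ⟨σs, hσs, hIs⟩ := I_pow_odd hsodd
      obtain ⟨σj, hσj, hIj⟩ := I_pow_odd hjodd
      have hσmem : σj * σs ∈ coeffField g :=
        mul_mem (by rcases hσj with rfl | rfl <;> simp) (by rcases hσs with rfl | rfl <;> simp)
      have hσnorm : ‖ι ⟨σj * σs, hσmem⟩‖ = 1 := by
        have h1 : (⟨σj * σs, hσmem⟩ : coeffField g) = 1 ∨ (⟨σj * σs, hσmem⟩ : coeffField g) = -1 := by
          rcases hσj with rfl | rfl <;> rcases hσs with rfl | rfl
          · left; exact Subtype.ext (by simp)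
          · right; exact Subtype.ext (by simp)
          · right; exact Subtype.ext (by simp)
          · left; exact Subtype.ext (by simp)
        rcases h1 with h | h <;> simp [h]
      have hkey : (⟨completedLValue g s / completedLValue g j, hR⟩ : coeffField g) * ⟨Aj, hmj⟩ =
          ⟨σj * σs, hσmem⟩ * ⟨As, hms⟩ := by
        apply Subtype.ext
        change completedLValue g s / completedLValue g j * Aj = σj * σs * As
        rw [hAj, hAs, hIs, hIj]
        rcases hσj with rfl | rfl <;> rcases hσs with rfl | rfl <;> field_simp
      have hnorm : ‖ι ⟨completedLValue g s / completedLValue g j, hR⟩‖ * ‖ι ⟨Aj, hmj⟩‖ = ‖ι ⟨As, hms⟩‖ := by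
        have := congrArg (fun x => ‖ι x‖) hkey
        simpa only [map_mul, norm_mul, hσnorm, one_mul] using this
      change ‖ι ⟨completedLValue g s / completedLValue g j, hR⟩‖ *
          ‖padicEval₂ F xk ((1 + (p : ℚ_[p])) ^ (j - 1) - 1)‖ = ‖padicEval₂ F xk ((1 + (p : ℚ_[p])) ^ (s - 1) - 1)‖
      rw [hFj, hFs]
      calc ‖ι ⟨completedLValue g s / completedLValue g j, hR⟩‖ * (‖Ω‖ * ‖ι ⟨Aj, hmj⟩‖)
          = ‖Ω‖ * (‖ι ⟨completedLValue g s / completedLValue g j, hR⟩‖ * ‖ι ⟨Aj, hmj⟩‖) := by ring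
        _ = ‖Ω‖ * ‖ι ⟨As, hms⟩‖ := by rw [hnorm]


/-- **A1 · `stub_interpolant` (DERIVED in v7 from G + L; registered statement unchanged) — the integral two-variable interpolant of the branch, in ratio/norm form
(arithmetic; the PRINTED package: Greenberg–Stevens 1993 Thm 5.15 / Kitagawa 1994 Thm 1.1 & Prop 5.12 two-variable
`p`-adic `L`-function of the ordinary `Λ`-adic form through `f_E` — `𝕀 = Λ` by (Br) + Hida control — with non-zero
`p`-adic periods at arithmetic points; Shimura 1977 algebraicity; non-vanishing of `L(g_k, j)` for `j < k/2`
(absolutely convergent Euler product at `k − j > k/2 + 1` + functional equation); Rohrlich 1984 + Mazur–Tate–Teitelbaum: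
`L_p(E) ≢ 0`, and `F(0, Y) = Per₂⁻¹·L_p(E)(Y)`).** For admissible `(W, p)` and a coprime slope pair `a/b < 1/2` there is
an INTEGRAL `F ∈ ℚ_p⟦X, Y⟧` such that (wt-2) the weight-2 fibre series `F(0, Y)` is not the zero series, and (interp) for
every branch member `(k, g, ι, s)` of the progression `2b(p−1) ∣ k − 2`, `b(s−1) = a(k−2)` and every odd reference index
`3 ≤ j`, `j ≡ 1 (mod p−1)`, strictly LEFT of the centre (`2j + 2 ≤ k`; the skeleton-vet repair of 2026-08-17): the value
`F(x_k, y_j)` is NON-ZERO and `‖ι(Λ(g,s)/Λ(g,j))‖ · ‖F(x_k, y_j)‖ = ‖F(x_k, y_s)‖`, `x_k = (1+p)^{k−2} − 1`,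
`y_n = (1+p)^{n−1} − 1` (same `p`-adic period, same sign `+`, unit Euler factors `(1 − p^{n−1}/α)(1 − p^{k−1−n}/α)` for
`2 ≤ n ≤ k−2` and at `n = s = 1` by `a_p ≢ 1`; tame component `ω⁰` on both sides). Vertical divisors of `F` are ALLOWED
(they are divided out in the proved analytic layer D). [cite: GreenbergStevens1993, Thm 5.15]
[cite: Kitagawa1994, Thm 1.1 and Prop 5.12] [cite: Rohrlich1984, Theorem] -/
theorem stub_interpolant :
    ∀ (W : WeierstrassCurve ℚ) [W.IsElliptic] [W.IsGloballyMinimal] (_ : NeZero (W.conductorNorm ℤ)) (p : ℕ)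
      [Fact p.Prime], 5 ≤ p → W.HasGoodReductionAtPrime p → ¬ (p : ℤ) ∣ W.frobeniusTrace p → ¬ (p : ℤ) ∣
      (W.frobeniusTrace p) ^ 2 - 1 → W.HasSurjectiveModNGaloisRep p → (∀ (M : ℕ) (_ : NeZero M) (g :
      CuspForm (CongruenceSubgroup.Gamma0 M) 2) (ι :
      Literature.NumberTheory.EllipticCurves.ModularForms.coeffField g →+* PadicAlgCl p), M ∣
      W.conductorNorm ℤ * p → Literature.NumberTheory.EllipticCurves.ModularForms.IsNewform0 g → ‖ι
      ⟨(UpperHalfPlane.qExpansion 1 ⇑g).coeff p,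
      Literature.NumberTheory.EllipticCurves.ModularForms.coeff_mem_coeffField g p⟩‖ = 1 → (∀ ℓ : ℕ, ℓ.Prime
      → ¬ ℓ ∣ W.conductorNorm ℤ * p → ‖ι ⟨(UpperHalfPlane.qExpansion 1 ⇑g).coeff ℓ,
      Literature.NumberTheory.EllipticCurves.ModularForms.coeff_mem_coeffField g ℓ⟩ - ((W.frobeniusTrace ℓ :
      ℤ) : PadicAlgCl p)‖ < 1) → M = W.conductorNorm ℤ ∧ ∀ n : ℕ, (UpperHalfPlane.qExpansion 1 ⇑g).coeff n =
      ((W.LFunction n : ℤ) : ℂ)) → ∀ (a b : ℕ), 0 < b → 2 * a < b → a.Coprime b → ∃ F : MvPowerSeries (Fin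
      2) ℚ_[p], Literature.NumberTheory.EllipticCurves.IsPadicInt F ∧ (∃ i : ℕ, MvPowerSeries.coeff (Finsupp.single 1 i) F ≠ 0) ∧ (∀ (k : ℤ) (g : CuspForm
      (CongruenceSubgroup.Gamma0 (W.conductorNorm ℤ)) k) (ι :
      Literature.NumberTheory.EllipticCurves.ModularForms.coeffField g →+* PadicAlgCl p) (s : ℕ), (2 * b *
      (p - 1) : ℤ) ∣ (k - 2) → (b : ℤ) * ((s : ℤ) - 1) = a * (k - 2) →
      Literature.NumberTheory.EllipticCurves.ModularForms.IsNewform0 g → ‖ι ⟨(UpperHalfPlane.qExpansion 1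
      ⇑g).coeff p, Literature.NumberTheory.EllipticCurves.ModularForms.coeff_mem_coeffField g p⟩‖ = 1 → (∀ ℓ
      : ℕ, ℓ.Prime → ¬ ℓ ∣ W.conductorNorm ℤ * p → ‖ι ⟨(UpperHalfPlane.qExpansion 1 ⇑g).coeff ℓ,
      Literature.NumberTheory.EllipticCurves.ModularForms.coeff_mem_coeffField g ℓ⟩ - ((W.frobeniusTrace ℓ :
      ℤ) : PadicAlgCl p)‖ < 1) → ∀ j : ℕ, Odd j → 3 ≤ j → (p - 1) ∣ (j - 1) → 2 * (j : ℤ) + 2 ≤ k →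
      Literature.NumberTheory.EllipticCurves.padicEval₂ F ((1 + (p : ℚ_[p])) ^ (k - 2) - 1) ((1 + (p :
      ℚ_[p])) ^ (j - 1) - 1) ≠ 0 ∧ ∀ hR : (∫ t in Set.Ioi (0 : ℝ), ((t : ℂ) ^ (s - 1)) * g
      (UpperHalfPlane.ofComplex ((t : ℂ) * Complex.I))) / (∫ t in Set.Ioi (0 : ℝ), ((t : ℂ) ^ (j - 1)) * g
      (UpperHalfPlane.ofComplex ((t : ℂ) * Complex.I))) ∈
      Literature.NumberTheory.EllipticCurves.ModularForms.coeffField g, ‖ι ⟨_, hR⟩‖ *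
      ‖Literature.NumberTheory.EllipticCurves.padicEval₂ F ((1 + (p : ℚ_[p])) ^ (k - 2) - 1) ((1 + (p :
      ℚ_[p])) ^ (j - 1) - 1)‖ = ‖Literature.NumberTheory.EllipticCurves.padicEval₂ F ((1 + (p : ℚ_[p])) ^ (k
      - 2) - 1) ((1 + (p : ℚ_[p])) ^ (s - 1) - 1)‖) :=
  stub_interpolant_of stub_twoVariableInterpolation stub_padicLFunctionNeZero

namespace Statement
/-- Statement of `stub_interpolant` (A1, derived). -/
abbrev stub_interpolant : Prop := type_of% @RatioMeasure.stub_interpolant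
end Statement

/-! ## The composition (sorry-free; the body is the landed `Theorems.EdgeCap_of_stubs`) -/

/-- **`EdgeCap_of`** (v8) — the four OPEN stub STATEMENTS M (Hida members), G (Greenberg–Stevens/Kitagawa interpolation),
L (modularity + Rohrlich) and A2∃ (arc bound for ONE interpolant — the heart) imply the crux `TangentCone.EdgeCap`, BY NAME:
A1 from G + L (`stub_interpolant_of`), A2 from A2∃ (landed transfer `arcDivisibility_of_exists`), then the landed composition
`EdgeCap_of_stubs` (coprime reduction, content division D, Strassmann S, uniform reference U, the ratio identity, the dichotomy
with T, `v_p(k−2) = v_p(b') + v_p(t)`). Axioms: propext, Classical.choice, Quot.sound. -/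
theorem EdgeCap_of (hM : Statement.stub_membersExist) (hG : Statement.stub_twoVariableInterpolation)
    (hL : Statement.stub_padicLFunctionNeZero) (hE : Statement.stub_arcDivisibilityExists) : EdgeCap :=
  Summit.BirchSwinnertonDyer.BirchSwinnertonDyer.Theorems.EdgeCap_of_stubs hM (stub_interpolant_of hG hL)
    (Summit.BirchSwinnertonDyer.BirchSwinnertonDyer.Theorems.arcDivisibility_of_exists hE)

/-- The crux along this line, MODULO the registered stubs (v8: M, G, L, A2∃). -/
theorem EdgeCap_proof : EdgeCap :=
  EdgeCap_of stub_membersExist stub_twoVariableInterpolation stub_padicLFunctionNeZero stub_arcDivisibilityExists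

end Summit.BirchSwinnertonDyer.BirchSwinnertonDyer.Cruxes.EdgeCap.RatioMeasure
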